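import Summits.QuantumFields.BalabanUV.T4Continuum.Support.NE3EndpointChart
import HarnessLib

/-!
# T⁴ programme, node NE3 — THE RE-TYPED ROOT T-E_w♯ FROM AN ENDPOINT CHART AND (P♮)_W BY NAME (class-generic and over
# `sfClass`): the END of the local half of NE3 on the fixed torus with NO path in the fibre among its hypotheses

NE3 (node U1b), row NE3 OWNER `b2b-balaban-t4-ne3-p1` (gen 24); design note `D-ne3p1-g24-1.md` (route Π), over
`NE3EndpointChart` (§5 `energyNormW_le_of_endpointChart`) and the junction `NE3EnergyRateWSupOfSlicePoincare` (`coer_of_slicePoincare_lambda`,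
`cLambda`, `curlPairedResidual_frameFreeBlockLandauW`).  The twin of the junction's §3∕§4 with `ChartPath` REPLACED by the WEAKER
`EndpointChart` (admissibility at the end only, a reference tangent direction `Xref ∈ T_♮(W)`, quadratic residual slack `q`):

* §1 **`ne3EnergyRateWSup_of_endpointChart`** (class-generic): per pair `EndpointChart` on `T_♮(W)` in `energyNormW` ∧ level data ∧
  `SlicePoincare L k W (T_♮(W)) CP (periodBox (N·L^k))` ∧ (RES♯) on `T_♮(W)`; uniformly `0 ≤ CP`, `CP·(√Λ−1)² ≤ 1∕4`, `0 ≤ θ₀`,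
  `0 ≤ C′`, budget `2Λθ + Λθ² + κ + 2q ≤ cΛ∕2` ⟹ `NE3EnergyRateWSup d 𝒞 L N b g ((1+θ₀)·(4∕cΛ)·C′) ((√Λ−1)∕(24√d)) dom`;
* §2 `cavg_mem_admissible_sfClass` — the field `admW` IS A THEOREM over `sfClass` (composition law `rescale_bavg_mem_admissible` +
  B7 Prop. 1 class transport `rescale_bavg_mem_sfClass`); **`ne3EnergyRateWSup_sfClass_of_endpointChart`** — the `sfClass` END
  with (RES♯) and unitarity discharged by name: T-E_w♯ ⇐ per pair (H∃)-type data ∧ `EndpointChart` ∧ level data ∧ (P♮)_W.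

HONEST FRAMING.  Kernel bookkeeping; `EndpointChart` and (P♮)_W are hypotheses here; T-E_w♯ and NE3 are NOT proved; spine PROVED
0∕9; finite T⁴ rung (B)+1 — NOT infinite volume, NOT mass gap, NOT `BetaPertH`, NOT Clay.  ABSOLUTE RULE kept.  PLACEMENT:
`Summits/QuantumFields/BalabanUV/`.  HONEST DEPENDENCY: continuum YM on T⁴ ⇐ BetaPertH ∧ nine spine estimates (0/9 proved);
BetaPertH ⇐ (D1) ∧ (D4) ∧ CAP+tail; G-an2-4 gates asym, D1 and NE2/3/4.
-/

set_option autoImplicit false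

open scoped BigOperators Matrix.Norms.L2Operator
open NormedSpace Finset

namespace Summit.QuantumFields.BalabanUV.T4Continuum.NE3EnergyRateWSupOfEndpointChart

open Set
open Literature.MathematicalPhysics.QuantumFieldTheory.Balaban1983to89
open B7Prop1Explicit B7Prop2Explicit
open T4AveragingDeficitWall hiding Site Plane Plaq Bond
open T4AveragingDeficitWallBoundary (periodBox)
open AveragingDeficitPeriodicCounting (IsPeriodicDir)
open AveragingDeficitChartCalculus (cavg)
open AveragingDeficitMultiLevelPrep (LevelSmall)
open MinimalActionSandwich (IsMinimiser admissible rescale_bavg_mem_admissible)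
open MinimalActionRate (Regular sfClass rescale_bavg_mem_sfClass)
open NE3EnergyShapes (residualScale residualScale_nonneg)
open NE3EnergyChartLeaves (isUnitaryCfg_cavg_of_regular)
open NE3EnergyWeightedShapes (energyNormW CurlPairedResidual)
open NE3EnergyWeightedSupShape (NE3EnergyRateWSup)
open NE3EnergyRateWSupOfChart (sup_le_of_lambdaW)
open NE3SlicePoincareShape (SlicePoincare)
open NE3FrameFreeSliceW (frameFreeBlockLandauW)
open NE3EnergyRateWSupOfSlicePoincare (cLambda cLambda_pos coer_of_slicePoincare_lambda mem_frameFreeBlockLandauW_struct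
  curlPairedResidual_frameFreeBlockLandauW)
open NE3EndpointChart (EndpointChart energyNormW_le_of_endpointChart)

noncomputable section

variable {d : ℕ} {n : Type*} [Fintype n] [DecidableEq n]

/-! ## §1 The class-generic END from endpoint charts and (P♮)_W -/

/-- **T-E_w♯ FROM ENDPOINT CHARTS AND (P♮)_W BY NAME** (class-generic; `d ≥ 1`, `L, N ≥ 1`).  If at every level `k ≥ 1`, datum
`V ∈ dom` and minimiser pair `(U_A, U_B)` with `U_B` `Regular b g (k+1)`: `W := cavg L U_B` is unitary and there are an ENDPOINT chart on
`T_♮(W)` in `energyNormW L k W · (periodBox (N·L^k))` with UNIFORM `(θ, κ, θ₀, q)`, level data `(α, a)` (`(1 + 24√d(e^α−1)L^k)² +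
48·d·a·(L^k)² ≤ Λ`, `112·d·a·CP·(L^k)² ≤ 1∕(2·card n)`), `SlicePoincare L k W (T_♮(W)) CP (periodBox (N·L^k))` and (RES♯) on `T_♮(W)` with
`r = C′·residualScale`; and uniformly `0 ≤ CP`, `CP·(√Λ−1)² ≤ 1∕4`, `0 ≤ θ₀`, `0 ≤ C′`, `2Λθ + Λθ² + κ + 2q ≤ cΛ∕2` — THEN
**`NE3EnergyRateWSup d 𝒞 L N b g ((1+θ₀)·(4∕cΛ)·C′) ((√Λ − 1)∕(24√d)) dom`**. [folklore] -/
theorem ne3EnergyRateWSup_of_endpointChart [Nonempty n] (hd : 1 ≤ d) {𝒞 : ℕ → Set (Site d → Fin d → (Matrix n n ℂ)ˣ)}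
    {L N : ℕ} (hL : 1 ≤ L) (hN : 1 ≤ N) {b g : ℝ} {dom : Set (Site d → Fin d → (Matrix n n ℂ)ˣ)} {CP Λ θ κ θ₀ q C' : ℝ}
    (hCP : 0 ≤ CP) (hreg₁ : CP * (Real.sqrt Λ - 1) ^ 2 ≤ 1 / 4) (hθ₀ : 0 ≤ θ₀) (hC' : 0 ≤ C')
    (hbudget : 2 * Λ * θ + Λ * θ ^ 2 + κ + 2 * q ≤ cLambda n CP Λ / 2)
    (hchart : ∀ k : ℕ, 1 ≤ k → ∀ V ∈ dom, ∀ UA UB : Site d → Fin d → (Matrix n n ℂ)ˣ,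
      IsMinimiser d 𝒞 L N k V UA → IsMinimiser d 𝒞 L N (k + 1) V UB → Regular d L N b g (k + 1) UB →
        IsUnitaryCfg (cavg L UB) ∧
        ∃ (u : Site d → (Matrix n n ℂ)ˣ) (Γ Ψ Ψ' : ℝ → Site d → Fin d → Matrix n n ℂ) (Xref : Site d → Fin d → Matrix n n ℂ)
          (α a : ℝ), 0 ≤ α ∧ 0 ≤ a ∧
          EndpointChart 𝒞 L N k V UA UB u Γ Ψ Ψ' Xref (frameFreeBlockLandauW L N k (cavg L UB))
            (fun Y => energyNormW L k (cavg L UB) Y (periodBox (N * L ^ k))) θ κ θ₀ q a ∧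
          (∀ t (x : Site d) (μ : Fin d), ‖Γ t x μ‖ ≤ α) ∧
          (1 + 24 * Real.sqrt d * (Real.exp α - 1) * (L : ℝ) ^ k) ^ 2 + 48 * d * a * ((L : ℝ) ^ k) ^ 2 ≤ Λ ∧
          112 * (d : ℝ) * a * CP * ((L : ℝ) ^ k) ^ 2 ≤ 1 / (2 * (Fintype.card n : ℝ)) ∧
          SlicePoincare L k (cavg L UB) (frameFreeBlockLandauW L N k (cavg L UB)) CP (periodBox (N * L ^ k)) ∧
          CurlPairedResidual L k (cavg L UB) (frameFreeBlockLandauW L N k (cavg L UB))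
            (C' * residualScale d L N b g k) (periodBox (N * L ^ k))) :
    NE3EnergyRateWSup d 𝒞 L N b g ((1 + θ₀) * (4 / cLambda n CP Λ) * C') ((Real.sqrt Λ - 1) / (24 * Real.sqrt d)) dom := by
  have hc := cLambda_pos (n := n) (Λ := Λ) hCP
  intro k hk V hV UA UB hA hB hreg
  obtain ⟨hW, u, Γ, Ψ, Ψ', Xref, α, a, hα, ha, hpath, hΓα, hΛw, hreg₂, hP, hres⟩ := hchart k hk V hV UA UB hA hB hreg
  have hM : 1 ≤ N * L ^ k := Nat.mul_pos (by omega) (Nat.pow_pos (by omega))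
  have hskewT : ∀ Y ∈ frameFreeBlockLandauW (d := d) (n := n) L N k (cavg L UB), IsSkewDir Y :=
    fun Y hY => (mem_frameFreeBlockLandauW_struct hY).1
  have hperT : ∀ Y ∈ frameFreeBlockLandauW (d := d) (n := n) L N k (cavg L UB), IsPeriodicDir Y ((N * L ^ k : ℕ) : ℤ) :=
    fun Y hY => (mem_frameFreeBlockLandauW_struct hY).2.1
  have hcoer := coer_of_slicePoincare_lambda hL k hM hW hskewT hperT hCP hP hpath.skew hα hΓα ha hpath.small hΛw hreg₁ hreg₂
  have hr : 0 ≤ C' * residualScale d L N b g k := mul_nonneg hC' (residualScale_nonneg d L N b g k)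
  have hend := energyNormW_le_of_endpointChart hL hN hW hα ha hpath hcoer hΓα hΛw hres hA hθ₀ hr hc hbudget
  have hsup := sup_le_of_lambdaW hd hL k hα ha hΛw
  refine ⟨u, Γ 0, hpath.gauge.1, hpath.gauge.2, hpath.skew 0, hpath.per 0, hpath.rep, ?_, fun x μ => (hΓα 0 x μ).trans hsup⟩
  have hcv : cavg L UB = rescale L (bavg L UB) := rfl
  rw [hcv] at hend
  refine hend.trans (le_of_eq ?_)
  ring

/-! ## §2 Over `sfClass`: the end admissibility, (RES♯) and unitarity discharged by name -/

/-- **THE FIELD `admW` IS A THEOREM OVER `sfClass`**: for a run-B configuration `U_B ∈ admissible (sfClass d L N ε) L (k+1) V` that is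
`Regular d L N b g (k+1)`, with `512(d+1)(d+4)L²b ≤ 1` and `b + 226(8(d+1)(d+4))²b² ≤ ε`: `cavg L U_B ∈ admissible (sfClass d L N ε) L k V`
(composition law `rescale_bavg_mem_admissible` + class transport `rescale_bavg_mem_sfClass`). [folklore] -/
theorem cavg_mem_admissible_sfClass [Nonempty n] {L N : ℕ} (hL : 1 ≤ L) {b g ε : ℝ} (hb : 0 ≤ b)
    (hbs : 512 * (d + 1) * (d + 4) * (L : ℝ) ^ 2 * b ≤ 1) (hbε : b + 226 * (8 * (d + 1) * (d + 4)) ^ 2 * b ^ 2 ≤ ε)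
    {k : ℕ} {V UB : Site d → Fin d → (Matrix n n ℂ)ˣ} (hUB : UB ∈ admissible (sfClass d L N ε) L (k + 1) V)
    (hreg : Regular d L N b g (k + 1) UB) :
    cavg L UB ∈ admissible (sfClass d L N ε) L k V :=
  rescale_bavg_mem_admissible hUB (rescale_bavg_mem_sfClass hL hb hbs hbε hreg)

/-- **T-E_w♯ OVER `sfClass` FROM ENDPOINT CHARTS AND (P♮)_W BY NAME** (`d ≥ 2`, `L, N ≥ 1`, `0 ≤ b < ε`, `g > 0`, row Y9's multi-level
smallness at every level).  If at every level `j+1`, datum `V ∈ dom` and pair of minimisers `(U_A, U_B)` of `sfClass d L N ε` with `U_B`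
`Regular d L N b g (j+2)` there are an ENDPOINT chart on `T_♮(cavg L U_B)` in the weighted norm with UNIFORM `(θ, κ, θ₀, q)`, level data
`(α, a)` and `SlicePoincare L (j+1) (cavg L U_B) (T_♮) CP (periodBox (N·L^{j+1}))` — THEN
`NE3EnergyRateWSup d (sfClass d L N ε) L N b g ((1+θ₀)·(4∕cΛ)·C′_{R♯5d}) ((√Λ−1)∕(24√d)) dom`.  The END's hypotheses: (H∃)-type pair data,
`EndpointChart` (L1 REP + an explicit path — NO fibre chart), level data, (P♮)_W. [folklore] -/
theorem ne3EnergyRateWSup_sfClass_of_endpointChart [Nonempty n] (hd : 2 ≤ d) {L N : ℕ} [NeZero L] [NeZero N] (hL : 1 ≤ L)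
    (hN : 1 ≤ N) {ε b g : ℝ} (hb : 0 ≤ b) (hbε : b < ε) (hg : 0 < g)
    (hsmall : ∀ j : ℕ, LevelSmall d L (j + 1) (ε / ((L : ℝ) ^ (j + 2)) ^ 2))
    {dom : Set (Site d → Fin d → (Matrix n n ℂ)ˣ)} {CP Λ θ κ θ₀ q : ℝ}
    (hCP : 0 ≤ CP) (hreg₁ : CP * (Real.sqrt Λ - 1) ^ 2 ≤ 1 / 4) (hθ₀ : 0 ≤ θ₀)
    (hbudget : 2 * Λ * θ + Λ * θ ^ 2 + κ + 2 * q ≤ cLambda n CP Λ / 2)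
    (hchart : ∀ j : ℕ, ∀ V ∈ dom, ∀ UA UB : Site d → Fin d → (Matrix n n ℂ)ˣ,
      IsMinimiser d (sfClass d L N ε) L N (j + 1) V UA → IsMinimiser d (sfClass d L N ε) L N (j + 2) V UB →
        Regular d L N b g (j + 2) UB →
        ∃ (u : Site d → (Matrix n n ℂ)ˣ) (Γ Ψ Ψ' : ℝ → Site d → Fin d → Matrix n n ℂ) (Xref : Site d → Fin d → Matrix n n ℂ)
          (α a : ℝ), 0 ≤ α ∧ 0 ≤ a ∧
          EndpointChart (sfClass d L N ε) L N (j + 1) V UA UB u Γ Ψ Ψ' Xref (frameFreeBlockLandauW L N (j + 1) (cavg L UB))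
            (fun Y => energyNormW L (j + 1) (cavg L UB) Y (periodBox (N * L ^ (j + 1)))) θ κ θ₀ q a ∧
          (∀ t (x : Site d) (μ : Fin d), ‖Γ t x μ‖ ≤ α) ∧
          (1 + 24 * Real.sqrt d * (Real.exp α - 1) * (L : ℝ) ^ (j + 1)) ^ 2 + 48 * d * a * ((L : ℝ) ^ (j + 1)) ^ 2 ≤ Λ ∧
          112 * (d : ℝ) * a * CP * ((L : ℝ) ^ (j + 1)) ^ 2 ≤ 1 / (2 * (Fintype.card n : ℝ)) ∧
          SlicePoincare L (j + 1) (cavg L UB) (frameFreeBlockLandauW L N (j + 1) (cavg L UB)) CP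
            (periodBox (N * L ^ (j + 1)))) :
    NE3EnergyRateWSup d (sfClass d L N ε) L N b g
      ((1 + θ₀) * (4 / cLambda n CP Λ)
        * (Real.sqrt ((L : ℝ) ^ (d - 2))
            + (Real.sqrt ((L : ℝ) ^ (d - 2)) * Real.sqrt (8 * Fintype.card (T4AveragingDeficitWall.Plane d))
                * (128 * (d * (L : ℝ) ^ 2))
              + 2 * (2048 * ((d : ℝ) + 4) ^ 2 * (L : ℝ) ^ 2 * Real.sqrt (d * (L : ℝ) ^ d))) * b
            + b ^ 2 * (2 * (L : ℝ) ^ (d - 1) + 2 * (8 * d * (L : ℝ) ^ d)) * Real.sqrt (d / (g * (L : ℝ) ^ (d + 2)))))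
      ((Real.sqrt Λ - 1) / (24 * Real.sqrt d)) dom := by
  have hC' : 0 ≤ Real.sqrt ((L : ℝ) ^ (d - 2))
      + (Real.sqrt ((L : ℝ) ^ (d - 2)) * Real.sqrt (8 * Fintype.card (T4AveragingDeficitWall.Plane d))
          * (128 * (d * (L : ℝ) ^ 2))
        + 2 * (2048 * ((d : ℝ) + 4) ^ 2 * (L : ℝ) ^ 2 * Real.sqrt (d * (L : ℝ) ^ d))) * b
      + b ^ 2 * (2 * (L : ℝ) ^ (d - 1) + 2 * (8 * d * (L : ℝ) ^ d)) * Real.sqrt (d / (g * (L : ℝ) ^ (d + 2))) := by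
    positivity
  refine ne3EnergyRateWSup_of_endpointChart (by omega) hL hN hCP hreg₁ hθ₀ hC' hbudget ?_
  intro k hk V hV UA UB hA hB hreg
  obtain ⟨j, rfl⟩ : ∃ j, k = j + 1 := ⟨k - 1, by omega⟩
  have hW : IsUnitaryCfg (cavg L UB) := isUnitaryCfg_cavg_of_regular hL j hb hbε (hsmall j) hreg
  obtain ⟨u, Γ, Ψ, Ψ', Xref, α, a, hα, ha, hpath, hΓα, hΛw, hreg₂, hP⟩ := hchart j V hV UA UB hA hB hreg
  exact ⟨hW, u, Γ, Ψ, Ψ', Xref, α, a, hα, ha, hpath, hΓα, hΛw, hreg₂, hP,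
    curlPairedResidual_frameFreeBlockLandauW hd hL hN j hb hbε hg (hsmall j) hB hreg⟩

end

end Summit.QuantumFields.BalabanUV.T4Continuum.NE3EnergyRateWSupOfEndpointChart
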